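import Summits.Ventures.PackingBounds.Configurations.SubspaceTransfer
import Summits.Ventures.PackingBounds.Energy.UniversalOptimality

/-!
# The regular simplex as an explicit `N`-point configuration on `S^{n-1}` (`2 ≤ N ≤ n + 1`), every `n`

Framing: lottery ticket; floor = certified bounds/negative ranges. Venture `PackingBounds` (cell
`pub-packcert`, seat `pub-packcert-energy`) — the **attained side**, structural (all `n`, `N`).

For `2 ≤ N ≤ n + 1` the `N` points `e_i - (1/N) Σ_{j<N} e_j` of `ℝ^{n+1}` (`i < N`) are orthogonal to
`u = Σ_{j<N} e_j ≠ 0` and, normalised, have pairwise inner products `-1/(N-1)`; the codimension-one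
transfer `Config.exists_transfer_orthogonal_singleton` moves them to `ℝⁿ` (`exists_config`). Their
`a`-energy is `N (N-1) a(-1/(N-1))`, which by the cell's universal optimality of simplices
(`Energy.UniversalSimplex…`, all `n ≥ 3`, kernel-checked two-row certificate) is the ground-state
energy of `N` points on `S^{n-1}` for every absolutely monotonic potential (`energy_isLeast`).

## References
* H. Cohn, A. Kumar, J. Amer. Math. Soc. 20 (2007) 99–148, Thm 1.2, Table 1. [`CohnKumar2006`]
-/

namespace Summit.Ventures.PackingBounds.Config.Simplex

open Finset

variable {n N : ℕ}

/-- The basis vector `e_i` of `ℝ^{n+1}` for `i < N ≤ n + 1`. -/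
private noncomputable def e (h : N ≤ n + 1) (i : Fin N) : EuclideanSpace ℝ (Fin (n + 1)) :=
  EuclideanSpace.single (Fin.castLE h i) 1

/-- `u = Σ_{j<N} e_j`. -/
private noncomputable def u (h : N ≤ n + 1) : EuclideanSpace ℝ (Fin (n + 1)) := ∑ j : Fin N, e h j

/-- The centred vertex `y_i = e_i - N⁻¹ u`. -/
private noncomputable def y (h : N ≤ n + 1) (i : Fin N) : EuclideanSpace ℝ (Fin (n + 1)) :=
  e h i - (N : ℝ)⁻¹ • u h

/-- The normalised vertex `x_i = √(N/(N-1)) y_i`. -/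
private noncomputable def x (h : N ≤ n + 1) (i : Fin N) : EuclideanSpace ℝ (Fin (n + 1)) :=
  Real.sqrt ((N : ℝ) / ((N : ℝ) - 1)) • y h i

/-- `⟪e_i, e_j⟫ = δ_ij`. -/
private theorem inner_e (h : N ≤ n + 1) (i j : Fin N) :
    inner ℝ (e h i) (e h j) = if i = j then 1 else 0 := by
  rw [e, e, EuclideanSpace.inner_single_left]
  simp only [conj_trivial, PiLp.single_apply, one_mul]
  by_cases hij : i = j
  · subst hij; simp
  · rw [if_neg (fun h' => hij ((Fin.castLE_injective h) h')), if_neg hij]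

/-- `⟪e_i, u⟫ = 1`. -/
private theorem inner_e_u (h : N ≤ n + 1) (i : Fin N) : inner ℝ (e h i) (u h) = 1 := by
  rw [u, inner_sum]
  simp_rw [inner_e]
  simp

/-- `⟪u, u⟫ = N`. -/
private theorem inner_u_u (h : N ≤ n + 1) : inner ℝ (u h) (u h) = N := by
  nth_rw 1 [u]
  rw [sum_inner]
  simp only [inner_e_u, sum_const, card_univ, Fintype.card_fin, nsmul_eq_mul, mul_one]

/-- `⟪u, y_i⟫ = 0`. -/
private theorem inner_u_y (h : N ≤ n + 1) (hN : N ≠ 0) (i : Fin N) : inner ℝ (u h) (y h i) = 0 := by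
  have hN' : (N : ℝ) ≠ 0 := by exact_mod_cast hN
  rw [y, inner_sub_right, real_inner_smul_right, real_inner_comm, inner_e_u, inner_u_u,
    inv_mul_cancel₀ hN', sub_self]

/-- `⟪y_i, y_j⟫ = δ_ij - 1/N`. -/
private theorem inner_y (h : N ≤ n + 1) (hN : N ≠ 0) (i j : Fin N) :
    inner ℝ (y h i) (y h j) = (if i = j then 1 else 0) - (N : ℝ)⁻¹ := by
  have hN' : (N : ℝ) ≠ 0 := by exact_mod_cast hN
  rw [y, y, inner_sub_left, inner_sub_right, inner_sub_right, real_inner_smul_left,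
    real_inner_smul_right, real_inner_smul_left, real_inner_smul_right, inner_e, inner_e_u,
    real_inner_comm (e h j), inner_e_u, inner_u_u, inv_mul_cancel₀ hN']
  ring

/-- `⟪x_i, x_j⟫ = 1` if `i = j`, `-1/(N-1)` otherwise. -/
private theorem inner_x (h : N ≤ n + 1) (h2 : 2 ≤ N) (i j : Fin N) :
    inner ℝ (x h i) (x h j) = if i = j then 1 else -1 / ((N : ℝ) - 1) := by
  have hN : (N : ℝ) ≠ 0 := by positivity
  have h2' : (2 : ℝ) ≤ N := by exact_mod_cast h2
  have hN1 : (N : ℝ) - 1 ≠ 0 := by linarith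
  have hq : (0 : ℝ) ≤ (N : ℝ) / ((N : ℝ) - 1) := div_nonneg (by positivity) (by linarith)
  rw [x, x, real_inner_smul_left, real_inner_smul_right, ← mul_assoc, ← sq, Real.sq_sqrt hq,
    inner_y h (by omega)]
  split_ifs with hij
  · rw [div_mul_eq_mul_div, div_eq_iff hN1]
    field_simp
  · rw [div_mul_eq_mul_div, div_eq_div_iff hN1 hN1]
    field_simp
    ring

/-- `x` is injective. -/
private theorem x_injective (h : N ≤ n + 1) (h2 : 2 ≤ N) : Function.Injective (x h) := by
  intro i j hij
  by_contra hne
  have h1 := inner_x h h2 i j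
  rw [hij, if_neg hne, inner_x h h2 j j, if_pos rfl] at h1
  have : (2 : ℝ) ≤ N := by exact_mod_cast h2
  have h3 : (-1 : ℝ) / ((N : ℝ) - 1) < 0 := div_neg_of_neg_of_pos (by norm_num) (by linarith)
  linarith

/-- **The regular simplex configuration.** For `2 ≤ N ≤ n + 1` there are `N` unit vectors of `ℝⁿ`
with all pairwise inner products `-1/(N-1)`; their `a`-energy is `N (N-1) a(-1/(N-1))` for every
potential `a`. [cite: CohnKumar2006, Table 1] -/
theorem exists_config (h2 : 2 ≤ N) (h : N ≤ n + 1) :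
    ∃ C : Finset (EuclideanSpace ℝ (Fin n)), C.card = N ∧ (∀ z ∈ C, ‖z‖ = 1) ∧
      (∀ z ∈ C, ∀ w ∈ C, z ≠ w → inner ℝ z w = -1 / ((N : ℝ) - 1)) ∧
      ∀ a : ℝ → ℝ, ∑ z ∈ C, ∑ w ∈ C.erase z, a (inner ℝ z w) =
        (N : ℝ) * (((N : ℝ) - 1) * a (-1 / ((N : ℝ) - 1))) := by
  classical
  set C0 : Finset (EuclideanSpace ℝ (Fin (n + 1))) := (univ : Finset (Fin N)).map ⟨x h, x_injective h h2⟩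
    with hC0
  have hmem : ∀ z ∈ C0, ∃ i, x h i = z := fun z hz => by
    obtain ⟨i, -, rfl⟩ := Finset.mem_map.1 hz; exact ⟨i, rfl⟩
  have hnorm0 : ∀ z ∈ C0, ‖z‖ = 1 := by
    intro z hz
    obtain ⟨i, rfl⟩ := hmem z hz
    have h1 := inner_x h h2 i i
    rw [if_pos rfl, real_inner_self_eq_norm_sq] at h1
    nlinarith [norm_nonneg (x h i)]
  have hinner0 : ∀ z ∈ C0, ∀ w ∈ C0, z ≠ w → inner ℝ z w = -1 / ((N : ℝ) - 1) := by
    intro z hz w hw hzw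
    obtain ⟨i, rfl⟩ := hmem z hz
    obtain ⟨j, rfl⟩ := hmem w hw
    rw [inner_x h h2, if_neg (fun hij => hzw (by rw [hij]))]
  have hu : u h ≠ 0 := by
    intro h0
    have h1 := inner_u_u h
    rw [h0, inner_zero_left] at h1
    have : (2 : ℝ) ≤ N := by exact_mod_cast h2
    linarith
  have horth : ∀ z ∈ C0, inner ℝ (u h) z = 0 := by
    intro z hz
    obtain ⟨i, rfl⟩ := hmem z hz
    rw [x, real_inner_smul_right, inner_u_y h (by omega), mul_zero]
  obtain ⟨C, hcard, hnorm, hinner, henergy⟩ :=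
    exists_transfer_orthogonal_singleton (n := n) (u h) hu C0 horth
  refine ⟨C, ?_, ?_, ?_, ?_⟩
  · rw [hcard, hC0, card_map, card_univ, Fintype.card_fin]
  · intro z hz
    obtain ⟨z0, hz0, he⟩ := hnorm z hz
    rw [he]; exact hnorm0 z0 hz0
  · intro z hz w hw hzw
    obtain ⟨z0, hz0, w0, hw0, hne, he⟩ := hinner z hz w hw hzw
    rw [he]; exact hinner0 z0 hz0 w0 hw0 hne
  · intro a
    rw [henergy a]
    rw [Finset.sum_congr rfl (g := fun _ => ((N : ℝ) - 1) * a (-1 / ((N : ℝ) - 1)))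
      (fun z hz => by
        rw [Finset.sum_congr rfl (g := fun _ => a (-1 / ((N : ℝ) - 1))) (fun w hw => by
          rw [hinner0 z hz w (Finset.mem_of_mem_erase hw) (Finset.ne_of_mem_erase hw).symm]),
          sum_const, nsmul_eq_mul, Finset.card_erase_of_mem hz, hC0, card_map, card_univ,
          Fintype.card_fin, Nat.cast_sub (by omega), Nat.cast_one])]
    rw [sum_const, nsmul_eq_mul, hC0, card_map, card_univ, Fintype.card_fin]

/-- **Ground-state energy of `N` points on `S^{n-1}`, `2 ≤ N ≤ n + 1`, `n ≥ 3` (regular simplices).**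
For every potential `a` absolutely monotonic on `[-1,1)`, the least `a`-energy of `N` unit vectors of
`ℝⁿ` is `N (N-1) a(-1/(N-1))`, attained by the regular simplex (universal optimality, Cohn–Kumar
2007; lower bound kernel-checked in `Energy/UniversalOptimalitySimplex` for all `n ≥ 3` and `N ≥ 2`).
[cite: CohnKumar2006, Theorem 1.2] -/
theorem energy_isLeast (hn : 3 ≤ n) (h2 : 2 ≤ N) (h : N ≤ n + 1) (a : ℝ → ℝ)
    (ha : AbsolutelyMonotoneOn a (Set.Ico (-1) 1)) :
    IsLeast {E : ℝ | ∃ C : Finset (EuclideanSpace ℝ (Fin n)), (∀ z ∈ C, ‖z‖ = 1) ∧ C.card = N ∧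
      E = ∑ z ∈ C, ∑ w ∈ C.erase z, a (inner ℝ z w)}
      ((N : ℝ) * (((N : ℝ) - 1) * a (-1 / ((N : ℝ) - 1)))) := by
  obtain ⟨C, hc, hn1, -, he⟩ := exists_config h2 h
  refine ⟨⟨C, hn1, hc, (he a).symm⟩, ?_⟩
  rintro E ⟨C', h1, hN, rfl⟩
  exact Energy.UniversalSimplex.universallyOptimal_of_absolutelyMonotoneOn hn h2 a ha C' h1 hN

end Summit.Ventures.PackingBounds.Config.Simplex
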